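import Literature.Probability.RandomPlanarGeometry.HexSAWBrickWallWalks
import HarnessLib

/-!
# Inserting an even bridge at the last maximum: `c_n(ℍ) · b_{2M}(ℍ) ≤ (n+1) · c_{n+2M}(ℍ)`

Topic `Literature/Probability/RandomPlanarGeometry` (continues `HexSAWBrickWallWalks.lean`: honeycomb walks
`HexBW.saws n` in brick-wall coordinates, height = coordinate `0`, bridges `HexBW.bridges M`, the parity twist
`twistAt` and the reflection–translation lemma `adj_sigma_iff`).

Sources. N. Madras, G. Slade, *The Self-Avoiding Walk* (1993): §1.2, eq. (1.2.15) (concatenation of a walk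
and a bridge), §3.1, proof of Proposition 3.1.5 (reflection of the part of a walk after the LAST time its
height is maximal, in the hyperplane through that maximum — the Hammersley–Welsh unfolding step
[cite: HammersleyWelsh1962]), §7.5, eqs. (7.5.1)–(7.5.2) (Kesten 1963: the rate `N^{-1/3}` for `c_{N+2}/c_N`
on `ℤ^d`, printed without proof; in the tree's `ℤ^d` proof, `SAWKestenRatioRateAllDim`, the lower exponent `1/3`
comes from an insertion inequality "walk × short piece ↪ longer walks" with polynomial loss), §8.1 (proof of
Proposition 8.1.2, Fig. 8.1: the reflection device `T_M`).
The counting inequality in this form (reflection splice at the last maximum) is the lane's device for the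
triangular lattice (`SAWTriangularBridgeInsertion`, seat a-p1), here carried over to the honeycomb lattice;
we have not located it in print.

## The construction on `ℍ`

Let `j` be the LAST time at which the height of the `n`-step walk `ω` is maximal (`= D`), `p = ω(j)`, and
let `β` be an `M`-step bridge from `0`.  The new `(n+M)`-step walk is
`ω[0..j] · (β placed at p) · σ(ω[j+1..n])`, where "placed at `p`" is `z ↦ twistAt p z + p` (a translation
for `p` even, a translation composed with `(x,y) ↦ (x,−y)` for `p` odd — both carry the walk `β` from `0`
to a walk from `p` with the same heights), `p'` is the top of the placed bridge, and
`σ(y) = p' + (p − q) + R(y − q)`, `q = ω(j+1)`, `R` the reflection `x ↦ −x` of the height.  Since `j` is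
the last maximum, `q₀ = D − 1`, so `p − q = e₀` and `σ(q) = p' + e₀` is joined to `p'` by a horizontal
bond (always present); the three blocks occupy the height ranges `≤ D`, `(D, D + β(M)₀]`,
`> D + β(M)₀`.  The map `σ` is an automorphism of the brick wall iff `p'` and `p` have the same parity,
i.e. iff **`M` is even** (the honeycomb lattice is bipartite and every step changes the class); odd pieces
cannot be spliced this way in any frame-independent sense.  For FIXED `j` the map `(ω, β) ↦ ω̃` is
injective, whence `c_n · b_M ≤ (n+1) · c_{n+M}` for even `M`.

## Main statements (namespace `Literature.Probability.RandomPlanarGeometry.SAW.HexBW`)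

* `BridgeInsertion.insertBridge`, `insertBridge_mem`, `insertBridge_injective`, `lastMaxClass`,
  `saws_subset_biUnion_lastMaxClass`, `card_lastMaxClass_mul_bridgeCount_le`;
* **`hexSawCount_mul_bridgeCount_le : c_n(ℍ) · b_M(ℍ) ≤ (n+1) · c_{n+M}(ℍ)`** for EVEN `M`;
* `hexSawCount_mul_bridgeCount_two_mul_le_pow_six` — the shape `hSM` of the tree's rate engine
  `Zd.KestenRateLower.lower_rate_cubeRoot_ins` with `e M := b_{2M}(ℍ)`, threshold `n₁ = 0`, any parity `r`.
-/

noncomputable section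

open Finset Function Literature.Probability.LatticeModels Literature.Probability.Percolation SimpleGraph

namespace Literature.Probability.RandomPlanarGeometry.SAW

namespace HexBW

/-- The twist preserves the parity of `x + y`. [cite: EntingJensen2009, §7.4.2, Fig. 7.10 (brickwork form of the honeycomb lattice)] -/
theorem parity_twistAt (p z : Site 2) : (twistAt p z 0 + twistAt p z 1) % 2 = (z 0 + z 1) % 2 := by
  unfold twistAt
  split_ifs
  · rfl
  · rw [negY_apply_zero, negY_apply_one]
    omega

namespace BridgeInsertion

/-! ### Placing a walk at a site, and the reflection–translation `σ` -/

/-- Place the site `z` (of a walk from `0`) at `p`: `twistAt p z + p`. [cite: MadrasSlade1993, §1.2 (eq. (1.2.15), translation of the second walk)] -/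
def placeAt (p z : Site 2) : Site 2 := twistAt p z + p

/-- Height of the placed site. [cite: MadrasSlade1993, §1.2] -/
theorem placeAt_apply_zero (p z : Site 2) : placeAt p z 0 = z 0 + p 0 := by
  rw [placeAt, Pi.add_apply, twistAt_apply_zero]

/-- `placeAt p 0 = p`. [cite: MadrasSlade1993, §1.2] -/
@[simp] theorem placeAt_zero (p : Site 2) : placeAt p 0 = p := by
  rw [placeAt, twistAt_zero, zero_add]

/-- `placeAt p` is injective. [cite: MadrasSlade1993, §1.2] -/
theorem placeAt_injective (p : Site 2) : Function.Injective (placeAt p) := fun _ _ h =>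
  twistAt_injective p (add_right_cancel h)

/-- `placeAt p` carries brick-wall bonds to brick-wall bonds. [cite: EntingJensen2009, §7.4.2, Fig. 7.10 (brickwork form of the honeycomb lattice)] -/
theorem adj_placeAt_iff (p x y : Site 2) :
    brickWallGraph.Adj (placeAt p x) (placeAt p y) ↔ brickWallGraph.Adj x y :=
  adj_twistAt_add_iff p x y

/-- Parity of the placed site: `parity (placeAt p z) = parity z + parity p`. [cite: EntingJensen2009, §7.4.2, Fig. 7.10 (brickwork form of the honeycomb lattice)] -/
theorem parity_placeAt (p z : Site 2) :
    (placeAt p z 0 + placeAt p z 1) % 2 = (z 0 + z 1 + (p 0 + p 1)) % 2 := by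
  have h := parity_twistAt p z
  simp only [placeAt, Pi.add_apply]
  omega

/-- `σ_{c,a}(y) = c + R(y − a)`, `R` the reflection `x ↦ −x` of the height, normalised by `σ_{c,a}(a) = c`.
[cite: MadrasSlade1993, §3.1 (proof of Proposition 3.1.5: reflection in the hyperplane `x₁ = A₁(ω)`)] -/
def sigmaMap (c a y : Site 2) : Site 2 := c + Zd.reflCoord 0 (y - a)

/-- The reflection of the height fixes the origin. [cite: MadrasSlade1993, §3.1] -/
private theorem reflCoord_zero_zero : Zd.reflCoord (0 : ℤ) (0 : Site 2) = 0 :=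
  (Zd.reflCoord_eq_self_iff 0 0).2 rfl

/-- `σ_{c,a}(a) = c`. [cite: MadrasSlade1993, §3.1] -/
theorem sigmaMap_self (c a : Site 2) : sigmaMap c a a = c := by
  rw [sigmaMap, sub_self, reflCoord_zero_zero, add_zero]

/-- The height of `σ_{c,a}(y)` is `c₀ + a₀ − y₀`. [cite: MadrasSlade1993, §3.1] -/
theorem sigmaMap_apply_zero (c a y : Site 2) : sigmaMap c a y 0 = c 0 + a 0 - y 0 := by
  simp only [sigmaMap, Pi.add_apply, Zd.reflCoord_apply_zero, Pi.sub_apply]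
  ring

/-- `σ_{c,a}` is injective. [cite: MadrasSlade1993, §3.1] -/
theorem sigmaMap_injective (c a : Site 2) : Function.Injective (sigmaMap c a) := by
  intro y y' h
  have h1 := add_left_cancel h
  have h2 := Zd.reflCoord_injective (d := 2) 0 h1
  exact sub_left_injective h2

/-- `σ_{c,a}` is an automorphism of the brick wall when `c` and `a` have the same parity.
[cite: EntingJensen2009, §7.4.2, Fig. 7.10 (brickwork form of the honeycomb lattice)] -/
theorem sigmaMap_adj {c a y y' : Site 2} (hca : (c 0 + c 1) % 2 = (a 0 + a 1) % 2)
    (h : brickWallGraph.Adj y y') : brickWallGraph.Adj (sigmaMap c a y) (sigmaMap c a y') :=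
  (adj_sigma_iff hca y y').2 h

/-! ### The insertion map -/

/-- **Insert the bridge `β` into `ω` at time `j`**: `ω[0..j]`, then `β` placed at `ω(j)`, then the image of
`ω[j+1..]` under `σ_{c,a}` with `a = ω(j+1)` and `c = p' + (ω(j) − ω(j+1))`, `p'` the top of the placed
bridge; for `j = n` (the length of `ω`) this is the concatenation `ω · β`.
[cite: MadrasSlade1993, §8.1 (proof of Proposition 8.1.2, Fig. 8.1: the reflection `T_M`), §1.2 eq. (1.2.15)] -/
def insertBridge (j M : ℕ) (ω β : ℕ → Site 2) : ℕ → Site 2 := fun i =>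
  if i ≤ j then ω i
  else if i ≤ j + M then placeAt (ω j) (β (i - j))
  else sigmaMap (placeAt (ω j) (β M) + (ω j - ω (j + 1))) (ω (j + 1)) (ω (i - M))

variable {j M n : ℕ} {ω β : ℕ → Site 2}

/-- Values of the insertion map up to time `j`. [cite: MadrasSlade1993, §1.2] -/
theorem insertBridge_of_le {i : ℕ} (h : i ≤ j) : insertBridge j M ω β i = ω i := by
  simp [insertBridge, h]

/-- Values of the insertion map inside the bridge. [cite: MadrasSlade1993, §1.2] -/
theorem insertBridge_mid {i : ℕ} (h1 : j < i) (h2 : i ≤ j + M) :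
    insertBridge j M ω β i = placeAt (ω j) (β (i - j)) := by
  simp [insertBridge, show ¬ i ≤ j by omega, h2]

/-- Values of the insertion map after the bridge. [cite: MadrasSlade1993, §3.1] -/
theorem insertBridge_of_gt {i : ℕ} (h : j + M < i) :
    insertBridge j M ω β i =
      sigmaMap (placeAt (ω j) (β M) + (ω j - ω (j + 1))) (ω (j + 1)) (ω (i - M)) := by
  simp [insertBridge, show ¬ i ≤ j by omega, show ¬ i ≤ j + M by omega]

/-- **The inserted walk is an `(n+M)`-step self-avoiding walk of `ℍ`** when `M` is even, `j ≤ n` is the last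
time at which the height of `ω` is maximal and `β` is a bridge: the blocks `ω[0..j]`, bridge, reflected tail
occupy the height ranges `≤ D`, `(D, D + β(M)₀]`, `> D + β(M)₀`, and `σ` is an automorphism because the top
of an even bridge has the parity of its bottom.
[cite: MadrasSlade1993, §3.1 (proof of Proposition 3.1.5) and §1.2 eq. (1.2.15)] -/
theorem insertBridge_mem (hω : ω ∈ saws n) (hβ : β ∈ bridges M) (hMe : M % 2 = 0) (hj : j ≤ n)
    (hmax : ∀ i ≤ n, ω i 0 ≤ ω j 0) (hlt : ∀ i, j < i → i ≤ n → ω i 0 < ω j 0) :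
    insertBridge j M ω β ∈ saws (n + M) := by
  obtain ⟨h0, hend, hadj, hinj⟩ := mem_saws_iff.1 hω
  obtain ⟨hβs, hβb⟩ := mem_bridges.1 hβ
  obtain ⟨hβ0, hβend, hβadj, hβinj⟩ := mem_saws_iff.1 hβs
  have hβ00 : β 0 0 = 0 := by rw [hβ0]; rfl
  -- heights of the bridge
  have hβpos : ∀ t, 1 ≤ t → t ≤ M → 0 < β t 0 := fun t h1 h2 => hβ00 ▸ (hβb t h1 h2).1
  have hβM0 : 0 ≤ β M 0 := by
    rcases Nat.eq_zero_or_pos M with hM | hM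
    · rw [hM, hβ00]
    · exact (hβpos M hM le_rfl).le
  have hβtop : ∀ t ≤ M, β t 0 ≤ β M 0 := by
    intro t ht
    rcases Nat.eq_zero_or_pos t with rfl | hpos
    · rwa [hβ00]
    · exact (hβb t hpos ht).2
  -- parity: the top of the placed bridge has the parity of `ω j`
  have hβMpar : (β M 0 + β M 1) % 2 = 0 := by
    rw [parity_apply hβs le_rfl]
    exact_mod_cast hMe
  have hp'par : (placeAt (ω j) (β M) 0 + placeAt (ω j) (β M) 1) % 2 = (ω j 0 + ω j 1) % 2 := by
    rw [parity_placeAt]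
    omega
  -- the step out of the last maximum is `−e₀`
  have hstep : j < n → ω j - ω (j + 1) = Pi.single 0 1 := fun hjn => by
    have h := eq_sub_single_of_adj_of_lt (hadj j hjn) (hlt (j + 1) (by omega) (by omega))
    rw [h, sub_sub_cancel]
  -- the parity hypothesis of `σ`
  have hca : j < n → ((placeAt (ω j) (β M) + (ω j - ω (j + 1))) 0 +
      (placeAt (ω j) (β M) + (ω j - ω (j + 1))) 1) % 2 = (ω (j + 1) 0 + ω (j + 1) 1) % 2 := fun hjn => by
    have h1 := parity_of_adj (hadj j hjn)
    simp only [Pi.add_apply, Pi.sub_apply]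
    omega
  refine mem_saws_iff.2 ⟨?_, ?_, ?_, ?_⟩
  · -- start
    rw [insertBridge_of_le (Nat.zero_le _), h0]
  · -- frozen after time `n + M`
    intro i hi
    rcases hj.lt_or_eq with hjn | hjn
    · rw [insertBridge_of_gt (by omega), insertBridge_of_gt (by omega), hend (i - M) (by omega),
        show n + M - M = n by omega]
    · -- `j = n`: plain concatenation
      subst hjn
      rcases hi.lt_or_eq with hi | hi
      · have ha : ω (j + 1) = ω j := hend (j + 1) (by omega)
        rw [insertBridge_of_gt hi, hend (i - M) (by omega), ha, sigmaMap_self, sub_self, add_zero]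
        rcases Nat.eq_zero_or_pos M with hM | hM
        · subst hM
          rw [insertBridge_of_le (by omega), Nat.add_zero, hβ0, placeAt_zero]
        · rw [insertBridge_mid (by omega) le_rfl, show j + M - j = M by omega]
      · rw [hi]
  · -- adjacency
    intro i hi
    rcases Nat.lt_or_ge (i + 1) (j + 1) with h1 | h1
    · -- both times `≤ j`
      rw [insertBridge_of_le (by omega : i ≤ j), insertBridge_of_le (by omega : i + 1 ≤ j)]
      exact hadj i (by omega)
    rcases Nat.lt_or_ge i (j + M) with h2 | h2
    · -- inside the bridge (`M ≥ 1`)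
      rcases (show j ≤ i by omega).eq_or_lt with h3 | h3
      · subst h3
        rw [insertBridge_of_le le_rfl, insertBridge_mid (by omega) (by omega),
          show j + 1 - j = 1 by omega]
        have := (adj_placeAt_iff (ω j) (β 0) (β 1)).2 (hβadj 0 (by omega))
        rwa [hβ0, placeAt_zero] at this
      · rw [insertBridge_mid h3 h2.le, insertBridge_mid (by omega) (by omega),
          show i + 1 - j = (i - j) + 1 by omega]
        exact (adj_placeAt_iff _ _ _).2 (hβadj (i - j) (by omega))
    · -- at or after the top of the bridge; here `j < n`
      have hjn : j < n := by omega
      rcases h2.eq_or_lt with h3 | h3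
      · -- the joint `p' → σ(ω(j+1)) = p' + e₀`
        rw [← h3, insertBridge_of_gt (by omega : j + M < j + M + 1),
          show j + M + 1 - M = j + 1 by omega, sigmaMap_self, hstep hjn]
        rcases Nat.eq_zero_or_pos M with hM | hM
        · subst hM
          rw [insertBridge_of_le (by omega), Nat.add_zero, hβ0, placeAt_zero]
          exact adj_add_single _
        · rw [insertBridge_mid (by omega) le_rfl, show j + M - j = M by omega]
          exact adj_add_single _
      · -- inside the reflected tail
        rw [insertBridge_of_gt h3, insertBridge_of_gt (by omega),
          show i + 1 - M = (i - M) + 1 by omega]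
        exact sigmaMap_adj (hca hjn) (hadj (i - M) (by omega))
  · -- injectivity on `[0, n + M]`: heights separate the three blocks
    have hA : ∀ i ≤ j, insertBridge j M ω β i 0 ≤ ω j 0 := fun i hi => by
      rw [insertBridge_of_le hi]; exact hmax i (by omega)
    have hBlo : ∀ i, j < i → i ≤ j + M → ω j 0 < insertBridge j M ω β i 0 := fun i hi1 hi2 => by
      rw [insertBridge_mid hi1 hi2, placeAt_apply_zero]
      linarith [hβpos (i - j) (by omega) (by omega)]
    have hBhi : ∀ i, j < i → i ≤ j + M → insertBridge j M ω β i 0 ≤ ω j 0 + β M 0 := fun i hi1 hi2 => by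
      rw [insertBridge_mid hi1 hi2, placeAt_apply_zero]
      linarith [hβtop (i - j) (by omega)]
    have hC : ∀ i, j + M < i → i ≤ n + M → ω j 0 + β M 0 < insertBridge j M ω β i 0 := fun i hi1 hi2 => by
      rw [insertBridge_of_gt hi1, sigmaMap_apply_zero]
      simp only [Pi.add_apply, Pi.sub_apply, placeAt_apply_zero]
      linarith [hlt (i - M) (by omega) (by omega)]
    intro a ha b hb hab
    simp only [Set.mem_setOf_eq] at ha hb
    rcases le_or_gt a j with ha1 | ha1 <;> rcases le_or_gt b j with hb1 | hb1
    · rw [insertBridge_of_le ha1, insertBridge_of_le hb1] at hab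
      exact hinj (show a ≤ n by omega) (show b ≤ n by omega) hab
    · exfalso
      have h0 : insertBridge j M ω β a 0 = insertBridge j M ω β b 0 := by rw [hab]
      rcases le_or_gt b (j + M) with hb2 | hb2
      · linarith [hA a ha1, hBlo b hb1 hb2]
      · linarith [hA a ha1, hC b hb2 hb]
    · exfalso
      have h0 : insertBridge j M ω β a 0 = insertBridge j M ω β b 0 := by rw [hab]
      rcases le_or_gt a (j + M) with ha2 | ha2
      · linarith [hA b hb1, hBlo a ha1 ha2]
      · linarith [hA b hb1, hC a ha2 ha]
    · rcases le_or_gt a (j + M) with ha2 | ha2 <;> rcases le_or_gt b (j + M) with hb2 | hb2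
      · rw [insertBridge_mid ha1 ha2, insertBridge_mid hb1 hb2] at hab
        have e := hβinj (show a - j ≤ M by omega) (show b - j ≤ M by omega) (placeAt_injective _ hab)
        omega
      · exfalso
        have h0 : insertBridge j M ω β a 0 = insertBridge j M ω β b 0 := by rw [hab]
        linarith [hBhi a ha1 ha2, hC b hb2 hb]
      · exfalso
        have h0 : insertBridge j M ω β a 0 = insertBridge j M ω β b 0 := by rw [hab]
        linarith [hBhi b hb1 hb2, hC a ha2 ha]
      · rw [insertBridge_of_gt ha2, insertBridge_of_gt hb2] at hab
        have e := hinj (show a - M ≤ n by omega) (show b - M ≤ n by omega) (sigmaMap_injective _ _ hab)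
        omega

/-- **For fixed `j` and `M` the insertion map is injective** on pairs (walk, walk from `0` frozen after
`M`): the prefix and the placed bridge are read off directly, the value at time `j + M + 1` returns
`ω(j+1)`, which determines `σ`. [cite: MadrasSlade1993, §8.1 (proof of Proposition 8.1.2: "ζ uniquely determines the original polygon")] -/
theorem insertBridge_injective {ω' β' : ℕ → Site 2} (hβ : β ∈ saws M) (hβ' : β' ∈ saws M)
    (h : insertBridge j M ω β = insertBridge j M ω' β') : ω = ω' ∧ β = β' := by
  obtain ⟨hβ0, hβend, -, -⟩ := mem_saws_iff.1 hβ
  obtain ⟨hβ'0, hβ'end, -, -⟩ := mem_saws_iff.1 hβ'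
  have hA : ∀ i ≤ j, ω i = ω' i := fun i hi => by
    have e := congrFun h i
    rwa [insertBridge_of_le hi, insertBridge_of_le hi] at e
  have hωj := hA j le_rfl
  have hB : ∀ t, 1 ≤ t → t ≤ M → β t = β' t := fun t h1 h2 => by
    have e := congrFun h (j + t)
    rw [insertBridge_mid (by omega) (by omega), insertBridge_mid (by omega) (by omega),
      show j + t - j = t by omega, hωj] at e
    exact placeAt_injective _ e
  have hββ : β = β' := by
    funext t
    rcases Nat.eq_zero_or_pos t with ht | ht
    · rw [ht, hβ0, hβ'0]
    rcases le_or_gt t M with h2 | h2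
    · exact hB t ht h2
    · rw [hβend t h2.le, hβ'end t h2.le]
      rcases Nat.eq_zero_or_pos M with hM | hM
      · rw [hM, hβ0, hβ'0]
      · exact hB M hM le_rfl
  have hβM : β M = β' M := by rw [hββ]
  have hj1 : ω (j + 1) = ω' (j + 1) := by
    have e := congrFun h (j + M + 1)
    rw [insertBridge_of_gt (by omega), insertBridge_of_gt (by omega), show j + M + 1 - M = j + 1 by omega,
      sigmaMap_self, sigmaMap_self, hωj, hβM] at e
    exact sub_right_inj.1 (add_left_cancel e)
  have hC : ∀ k, j < k → ω k = ω' k := fun k hk => by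
    have e := congrFun h (k + M)
    rw [insertBridge_of_gt (by omega), insertBridge_of_gt (by omega), show k + M - M = k by omega,
      hωj, hβM, hj1] at e
    exact sigmaMap_injective _ _ e
  refine ⟨funext fun k => ?_, hββ⟩
  rcases le_or_gt k j with hk | hk
  · exact hA k hk
  · exact hC k hk

/-! ### The classes by the last time of maximal height -/

open Classical in
/-- The `n`-step walks of `ℍ` whose LAST time of maximal height is `j`. [cite: MadrasSlade1993, §3.1 (proof of
Proposition 3.1.5: `n₁(ω)`, "the largest value of `i` for which this maximum is attained")] -/
def lastMaxClass (n j : ℕ) : Finset (ℕ → Site 2) :=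
  (saws n).filter fun ω => (∀ i ≤ n, ω i 0 ≤ ω j 0) ∧ ∀ i, j < i → i ≤ n → ω i 0 < ω j 0

/-- Membership in `lastMaxClass`. [cite: MadrasSlade1993, §3.1 (proof of Proposition 3.1.5)] -/
theorem mem_lastMaxClass {n j : ℕ} {ω : ℕ → Site 2} :
    ω ∈ lastMaxClass n j ↔
      ω ∈ saws n ∧ (∀ i ≤ n, ω i 0 ≤ ω j 0) ∧ ∀ i, j < i → i ≤ n → ω i 0 < ω j 0 := by
  classical
  exact Finset.mem_filter

open Classical in
/-- Every walk lies in the class of its last time of maximal height (the tree's `Zd.lastArgmax`).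
[cite: MadrasSlade1993, §3.1 (proof of Proposition 3.1.5)] -/
theorem saws_subset_biUnion_lastMaxClass (n : ℕ) :
    saws n ⊆ (Finset.range (n + 1)).biUnion (lastMaxClass n) := by
  classical
  intro ω hω
  rw [Finset.mem_biUnion]
  obtain ⟨hjn, hjmax⟩ := Zd.lastArgmax_spec n ω
  refine ⟨Zd.lastArgmax n ω, Finset.mem_range.2 (by omega),
    mem_lastMaxClass.2 ⟨hω, fun i hi => ?_, fun i h1 h2 => ?_⟩⟩
  · rw [hjmax]; exact Zd.apply_le_maxLevel ω hi
  · rw [hjmax]; exact Zd.apply_lt_maxLevel_of_lastArgmax_lt ω h1 h2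

/-- **Class × even bridges injects into `(n+M)`-step walks**: `#(lastMaxClass n j) · b_M(ℍ) ≤ c_{n+M}(ℍ)` for
`j ≤ n` and even `M`. [cite: MadrasSlade1993, §1.2 eq. (1.2.15) and §3.1 (proof of Proposition 3.1.5)] -/
theorem card_lastMaxClass_mul_bridgeCount_le {n j : ℕ} (hj : j ≤ n) {M : ℕ} (hMe : M % 2 = 0) :
    #(lastMaxClass n j) * bridgeCount M ≤ hexSawCount (n + M) := by
  classical
  rw [bridgeCount, ← Finset.card_product, ← card_saws (n + M)]
  refine Finset.card_le_card_of_injOn (fun p => insertBridge j M p.1 p.2) ?_ ?_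
  · rintro ⟨ω, β⟩ hp
    simp only [Finset.mem_coe, Finset.mem_product, mem_lastMaxClass] at hp
    obtain ⟨⟨hω, hmax, hlt⟩, hβ⟩ := hp
    show insertBridge j M ω β ∈ (saws (n + M) : Set (ℕ → Site 2))
    rw [Finset.mem_coe]
    exact insertBridge_mem hω hβ hMe hj hmax hlt
  · rintro ⟨ω, β⟩ hp ⟨ω', β'⟩ hp' h
    simp only [Finset.mem_coe, Finset.mem_product, mem_lastMaxClass, mem_bridges] at hp hp'
    obtain ⟨hωω, hββ⟩ := insertBridge_injective hp.2.1 hp'.2.1 h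
    exact Prod.ext hωω hββ

end BridgeInsertion

open BridgeInsertion

/-! ### The insertion inequality -/

/-- **`c_n(ℍ) · b_M(ℍ) ≤ (n+1) · c_{n+M}(ℍ)` for every `n` and every EVEN `M`**: an even bridge can be inserted
into any `n`-step self-avoiding walk of the honeycomb lattice at the last time of maximal height (reflecting
the rest of the walk above the bridge), injectively once that time is known.
[cite: MadrasSlade1993, §7.5 eqs. (7.5.1)–(7.5.2) (the role of such an inequality in the tree's ℤ^d proof); §8.1
(proof of Proposition 8.1.2, Fig. 8.1) and §1.2 eq. (1.2.15) (the two devices: reflection after the maximum,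
concatenation with a bridge)] -/
theorem hexSawCount_mul_bridgeCount_le (n : ℕ) {M : ℕ} (hMe : M % 2 = 0) :
    hexSawCount n * bridgeCount M ≤ (n + 1) * hexSawCount (n + M) := by
  classical
  have h1 : #(saws n) ≤ ∑ j ∈ Finset.range (n + 1), #(lastMaxClass n j) :=
    (Finset.card_le_card (saws_subset_biUnion_lastMaxClass n)).trans Finset.card_biUnion_le
  rw [card_saws] at h1
  calc hexSawCount n * bridgeCount M
      ≤ (∑ j ∈ Finset.range (n + 1), #(lastMaxClass n j)) * bridgeCount M := Nat.mul_le_mul_right _ h1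
    _ = ∑ j ∈ Finset.range (n + 1), #(lastMaxClass n j) * bridgeCount M := Finset.sum_mul _ _ _
    _ ≤ ∑ j ∈ Finset.range (n + 1), hexSawCount (n + M) :=
      Finset.sum_le_sum fun j hj =>
        card_lastMaxClass_mul_bridgeCount_le (Nat.le_of_lt_succ (Finset.mem_range.1 hj)) hMe
    _ = (n + 1) * hexSawCount (n + M) := by rw [Finset.sum_const, Finset.card_range, smul_eq_mul]

/-- `c_n(ℍ) · b_{2M}(ℍ) ≤ (n+1) · c_{n+2M}(ℍ)` over `ℝ`. [cite: MadrasSlade1993, §7.5 eqs. (7.5.1)–(7.5.2)] -/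
theorem hexSawCount_mul_bridgeCount_two_mul_le_real (n M : ℕ) :
    (hexSawCount n : ℝ) * bridgeCount (2 * M) ≤ ((n : ℝ) + 1) * hexSawCount (n + 2 * M) := by
  exact_mod_cast hexSawCount_mul_bridgeCount_le n (M := 2 * M) (by omega)

/-- **`c_{N'}(ℍ) · b_{2M}(ℍ) ≤ (2(N' + 2M) + 3)^6 · c_{N'+2M}(ℍ)`** — the insertion inequality in the
polynomial-loss shape `hSM` consumed (with `e M := b_{2M}(ℍ)`, threshold `n₁ = 0`, either parity `r`) by the
tree's abstract lemma `Zd.KestenRateLower.lower_rate_cubeRoot_ins`; the true loss is `N' + 1`.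
[cite: MadrasSlade1993, §7.5 eqs. (7.5.1)–(7.5.2)] -/
theorem hexSawCount_mul_bridgeCount_two_mul_le_pow_six (N' M : ℕ) :
    (hexSawCount N' : ℝ) * bridgeCount (2 * M) ≤
      (2 * ((N' : ℝ) + 2 * M) + 3) ^ 6 * hexSawCount (N' + 2 * M) := by
  have h := hexSawCount_mul_bridgeCount_two_mul_le_real N' M
  have hm : (0 : ℝ) ≤ N' := Nat.cast_nonneg N'
  have hM : (0 : ℝ) ≤ M := Nat.cast_nonneg M
  have hx1 : (1 : ℝ) ≤ 2 * ((N' : ℝ) + 2 * M) + 3 := by linarith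
  have hx : (N' : ℝ) + 1 ≤ 2 * ((N' : ℝ) + 2 * M) + 3 := by linarith
  have hpoly : (N' : ℝ) + 1 ≤ (2 * ((N' : ℝ) + 2 * M) + 3) ^ 6 := hx.trans (le_self_pow₀ hx1 (by norm_num))
  exact h.trans (mul_le_mul_of_nonneg_right hpoly (Nat.cast_nonneg _))

end HexBW

end Literature.Probability.RandomPlanarGeometry.SAW
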